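import Mathlib
import Summits.Ventures.PercRepro2.CoinD21PrCellsA
import Summits.Ventures.PercRepro2.CoinD21PrCellsB
import Summits.Ventures.PercRepro2.CoinD21PrCellsC
import Summits.Ventures.PercRepro2.CoinD21PrAlg
import Summits.Ventures.PercRepro2.CoinOrTailAlg
import Summits.Ventures.PercRepro2.CoinOrTail3Cells

/-!
# The OR-tail with BOTH MARKERS ON ONE ROUTE over two log-supermodular branches: the abstract
functional (blind cell PercRepro2, night-2 g9; proofs/NIGHT2-DARC.md §38)

`orTailPr_functional_nonneg`: as `orTail3_functional_nonneg` (CoinOrTail3Alg.lean) — the tail is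
entered from `r` (probability `δ`) and from `q` (probability `ε`), the weight `ν` vanishes on the
sets containing `r` but not `p` — but the MARKERS are `p` and `r`: the far vertex and the
attachment point of the same route, the other entry `q` unmarked.  The sixteen three-marker cell
sums are the head values of the five-vertex core `s → p → r → a ← q ← s` with the markers `p, r`
(`d21pr_cert`, the staged 1,780-term certificate of CoinD21PrAlg.lean / CoinD21PrCells*.lean);
the class weights are absorbed by `α = 1, α' = 1/2, β = β' = γ = γ' = 1`, the six lsm steps hold
for the cell sums by Ahlswede–Daykin (`cellSum3_mul_le`), the four monotone steps termwise.
-/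

namespace Summit.Ventures.PercRepro2.Coin

section OrTailPrAlg

variable {V : Type*} [DecidableEq V] {R : Type*} [Field R] [LinearOrder R] [IsStrictOrderedRing R]

/-- **THE ONE-ROUTE TWO-MARKER OR-TAIL FUNCTIONAL IS NONNEGATIVE** (cell-averaging +
Ahlswede–Daykin + `d21pr_cert`).  Hypotheses: `a, w ∉ U`; `δ, ε ∈ [0, 1]`; `ν ≥ 0` log-supermodular on the subsets
of `U` and vanishing on the sets containing `r` but not `p`; `A ≥ 0` decreasing and
log-supermodular.  Conclusion: the cleared functional with the `R`-values `rVal A r q a δ ε`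
(the tail entered from `r` and `q`), the gate values `gVal A r q a w δ ε`, and the MARKERS
`x = 1[p ∈ W]`, `y = 1[r ∈ W]` is nonnegative. -/
theorem orTailPr_functional_nonneg (U : Finset V) (ν A : Finset V → R) (p r q a w : V) (δ ε : R)
    (haU : a ∉ U) (hwU : w ∉ U)
    (hδ0 : 0 ≤ δ) (hδ1 : δ ≤ 1) (hε0 : 0 ≤ ε) (hε1 : ε ≤ 1)
    (hν0 : ∀ W, 0 ≤ ν W) (hν : ∀ s ⊆ U, ∀ t ⊆ U, ν s * ν t ≤ ν (s ∩ t) * ν (s ∪ t))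
    (hbad : ∀ W ⊆ U, r ∈ W → p ∉ W → ν W = 0)
    (hA0 : ∀ W, 0 ≤ A W) (hA : ∀ s t : Finset V, A s * A t ≤ A (s ∩ t) * A (s ∪ t))
    (hAmono : ∀ s t : Finset V, s ⊆ t → A t ≤ A s) :
    0 ≤ (∑ W ∈ U.powerset, ν W * rVal A r q a δ ε W) ^ 2 *
          (∑ W ∈ U.powerset, ν W * gVal A r q a w δ ε W *
            ((if p ∈ W then (1 : R) else 0) * (if r ∈ W then (1 : R) else 0)))
        - (∑ W ∈ U.powerset, ν W * rVal A r q a δ ε W) *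
          (∑ W ∈ U.powerset, ν W * rVal A r q a δ ε W * (if p ∈ W then (1 : R) else 0)) *
          (∑ W ∈ U.powerset, ν W * gVal A r q a w δ ε W * (if r ∈ W then (1 : R) else 0))
        - (∑ W ∈ U.powerset, ν W * rVal A r q a δ ε W) *
          (∑ W ∈ U.powerset, ν W * rVal A r q a δ ε W * (if r ∈ W then (1 : R) else 0)) *
          (∑ W ∈ U.powerset, ν W * gVal A r q a w δ ε W * (if p ∈ W then (1 : R) else 0))
        + (∑ W ∈ U.powerset, ν W * rVal A r q a δ ε W * (if p ∈ W then (1 : R) else 0)) *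
          (∑ W ∈ U.powerset, ν W * rVal A r q a δ ε W * (if r ∈ W then (1 : R) else 0)) *
          (∑ W ∈ U.powerset, ν W * gVal A r q a w δ ε W) := by
  -- the fifteen cell sums (names as in `d21pr_cert`)
  set A_e := cellSum3 U ν A p r q false false false ∅ with hA_e
  set A_p := cellSum3 U ν A p r q true false false ∅ with hA_p
  set A_q := cellSum3 U ν A p r q false false true ∅ with hA_q
  set A_ap := cellSum3 U ν A p r q true false false {a} with hA_ap
  set A_aq := cellSum3 U ν A p r q false false true {a} with hA_aq
  set A_pq := cellSum3 U ν A p r q true false true ∅ with hA_pq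
  set A_pr := cellSum3 U ν A p r q true true false ∅ with hA_pr
  set A_apq := cellSum3 U ν A p r q true false true {a} with hA_apq
  set A_apr := cellSum3 U ν A p r q true true false {a} with hA_apr
  set A_aqw := cellSum3 U ν A p r q false false true {a, w} with hA_aqw
  set A_pqr := cellSum3 U ν A p r q true true true ∅ with hA_pqr
  set A_apqr := cellSum3 U ν A p r q true true true {a} with hA_apqr
  set A_apqw := cellSum3 U ν A p r q true false true {a, w} with hA_apqw
  set A_aprw := cellSum3 U ν A p r q true true false {a, w} with hA_aprw
  set A_apqrw := cellSum3 U ν A p r q true true true {a, w} with hA_apqrw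
  have hXa : Disjoint ({a} : Finset V) U := Finset.disjoint_singleton_left.2 haU
  have hXaw : Disjoint ({a, w} : Finset V) U := by
    rw [Finset.disjoint_left]
    intro x hx
    simp only [Finset.mem_insert, Finset.mem_singleton] at hx
    rcases hx with rfl | rfl
    · exact haU
    · exact hwU
  have hX0 : Disjoint (∅ : Finset V) U := Finset.disjoint_empty_left U
  have L := cellSum3_mul_le U ν A p r q hν0 hν hA0 hA
  -- the six log-supermodular steps
  have hl1 : A_apqr * A_apqw ≤ A_apq * A_apqrw := by
    have := L true true true true false true {a} {a, w} hXa hXaw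
    simpa only [Bool.and_self, Bool.and_false, Bool.false_and, Bool.or_self, Bool.true_or,
      Bool.or_true, Bool.false_or, singleton_inter_pair, singleton_union_pair] using this
  have hl2 : A_apr * A_apqw ≤ A_ap * A_apqrw := by
    have := L true true false true false true {a} {a, w} hXa hXaw
    simpa only [Bool.and_self, Bool.and_false, Bool.false_and, Bool.or_self, Bool.true_or,
      Bool.or_true, Bool.false_or, singleton_inter_pair, singleton_union_pair] using this
  have hl3 : A_aq * A_pq ≤ A_q * A_apq := by
    have := L false false true true false true {a} ∅ hXa hX0
    simpa only [Bool.and_self, Bool.and_false, Bool.false_and, Bool.or_self, Bool.true_or,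
      Bool.or_true, Bool.false_or, Finset.inter_empty, Finset.union_empty] using this
  have hl4 : A_p * A_aq ≤ A_e * A_apq := by
    have := L true false false false false true ∅ {a} hX0 hXa
    simpa only [Bool.and_self, Bool.and_false, Bool.false_and, Bool.or_self, Bool.true_or,
      Bool.or_true, Bool.false_or, Finset.empty_inter, Finset.empty_union] using this
  have hl5 : A_pqr * A_apqw ≤ A_pq * A_apqrw := by
    have := L true true true true false true ∅ {a, w} hX0 hXaw
    simpa only [Bool.and_self, Bool.and_false, Bool.false_and, Bool.or_self, Bool.true_or,
      Bool.or_true, Bool.false_or, Finset.empty_inter, Finset.empty_union] using this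
  have hl6 : A_pr * A_apqw ≤ A_p * A_apqrw := by
    have := L true true false true false true ∅ {a, w} hX0 hXaw
    simpa only [Bool.and_self, Bool.and_false, Bool.false_and, Bool.or_self, Bool.true_or,
      Bool.or_true, Bool.false_or, Finset.empty_inter, Finset.empty_union] using this
  -- the four monotone steps
  have M := cellSum3_mono U ν A p r q hν0 hAmono
  have ha_aw : ({a} : Finset V) ⊆ {a, w} := by simp
  have h0_a : (∅ : Finset V) ⊆ {a} := Finset.empty_subset _
  have h0_aw : (∅ : Finset V) ⊆ {a, w} := Finset.empty_subset _
  have hm1 : A_apqw ≤ A_apq := M true false true {a} {a, w} ha_aw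
  have hm2 : A_ap ≤ A_p := M true false false ∅ {a} h0_a
  have hm3 : A_apqw ≤ A_pq := M true false true ∅ {a, w} h0_aw
  have hm4 : A_apr ≤ A_pr := M true true false ∅ {a} h0_a
  have N := cellSum3_nonneg U ν A p r q hν0 hA0
  -- the staged certificate on the cell sums
  have key := d21pr_cert (1 : R) (1 / 2) 1 1 1 1 δ (1 - δ) ε (1 - ε) A_e A_p A_q A_ap A_aq A_pq
    A_pr A_apq A_apr A_aqw A_pqr A_apqr A_apqw A_aprw A_apqrw zero_le_one (by norm_num)
    zero_le_one zero_le_one zero_le_one zero_le_one hδ0 (sub_nonneg.2 hδ1) hε0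
    (sub_nonneg.2 hε1) (N _ _ _ _) (N _ _ _ _) (N _ _ _ _) (N _ _ _ _) (N _ _ _ _) (N _ _ _ _)
    (N _ _ _ _) (N _ _ _ _) (N _ _ _ _) (N _ _ _ _) (N _ _ _ _) (N _ _ _ _) (N _ _ _ _) (N _ _ _ _)
    hl1 hl2 hl3 hl4 hl5 hl6 hm1 hm2 hm3 hm4
  -- the seven moments as combinations of the cell sums (on the good sets)
  have hpt : ∀ W ∈ U.powerset,
      ν W * goodWt p r W * rVal A r q a δ ε W =
        ν W * cellWt3 p r q false false false W * A (W ∪ ∅)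
        + (ν W * cellWt3 p r q true false false W * A (W ∪ ∅))
        + (1 - ε) * (ν W * cellWt3 p r q false false true W * A (W ∪ ∅))
        + ε * (ν W * cellWt3 p r q false false true W * A (W ∪ {a}))
        + (1 - ε) * (ν W * cellWt3 p r q true false true W * A (W ∪ ∅))
        + ε * (ν W * cellWt3 p r q true false true W * A (W ∪ {a}))
        + (1 - δ) * (ν W * cellWt3 p r q true true false W * A (W ∪ ∅))
        + δ * (ν W * cellWt3 p r q true true false W * A (W ∪ {a}))
        + (1 - δ) * (1 - ε) * (ν W * cellWt3 p r q true true true W * A (W ∪ ∅))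
        + (δ * ε + δ * (1 - ε) + (1 - δ) * ε) * (ν W * cellWt3 p r q true true true W * A (W ∪ {a})) := by
    intro W _
    simp only [rVal, tailWt, cellWt3, mWt, goodWt, Finset.union_empty]
    by_cases hp : p ∈ W <;> by_cases hr : r ∈ W <;> by_cases hq : q ∈ W <;>
      simp [hp, hr, hq] <;> ring
  have hpg : ∀ W ∈ U.powerset,
      ν W * goodWt p r W * gVal A r q a w δ ε W =
        ν W * cellWt3 p r q false false false W * A (W ∪ ∅)
        + (ν W * cellWt3 p r q true false false W * A (W ∪ ∅))
        + (1 - ε) * (ν W * cellWt3 p r q false false true W * A (W ∪ ∅))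
        + ε * (ν W * cellWt3 p r q false false true W * A (W ∪ {a, w}))
        + (1 - ε) * (ν W * cellWt3 p r q true false true W * A (W ∪ ∅))
        + ε * (ν W * cellWt3 p r q true false true W * A (W ∪ {a, w}))
        + (1 - δ) * (ν W * cellWt3 p r q true true false W * A (W ∪ ∅))
        + δ * (ν W * cellWt3 p r q true true false W * A (W ∪ {a, w}))
        + (1 - δ) * (1 - ε) * (ν W * cellWt3 p r q true true true W * A (W ∪ ∅))
        + (δ * ε + δ * (1 - ε) + (1 - δ) * ε) * (ν W * cellWt3 p r q true true true W * A (W ∪ {a, w})) := by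
    intro W _
    simp only [gVal, tailWt, cellWt3, mWt, goodWt, Finset.union_empty]
    by_cases hp : p ∈ W <;> by_cases hr : r ∈ W <;> by_cases hq : q ∈ W <;>
      simp [hp, hr, hq] <;> ring
  have hΛ : ∑ W ∈ U.powerset, ν W * rVal A r q a δ ε W =
      A_e + A_p + (1 - ε) * A_q + ε * A_aq + (1 - ε) * A_pq + ε * A_apq + (1 - δ) * A_pr
        + δ * A_apr + (1 - δ) * (1 - ε) * A_pqr + (δ * ε + δ * (1 - ε) + (1 - δ) * ε) * A_apqr := by
    rw [sum_eq_sum_goodWt U ν p r hbad]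
    simp only [hA_e, hA_p, hA_q, hA_aq, hA_pq, hA_apq, hA_pr, hA_apr, hA_pqr, hA_apqr, cellSum3,
      Finset.mul_sum, ← Finset.sum_add_distrib]
    exact Finset.sum_congr rfl hpt
  have hFa : ∑ W ∈ U.powerset, ν W * rVal A r q a δ ε W * (if p ∈ W then (1 : R) else 0) =
      A_p + (1 - ε) * A_pq + ε * A_apq + (1 - δ) * A_pr + δ * A_apr + (1 - δ) * (1 - ε) * A_pqr
        + (δ * ε + δ * (1 - ε) + (1 - δ) * ε) * A_apqr := by
    rw [sum_eq_sum_goodWt' U ν p r hbad]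
    simp only [hA_p, hA_pq, hA_apq, hA_pr, hA_apr, hA_pqr, hA_apqr, cellSum3, Finset.mul_sum,
      ← Finset.sum_add_distrib]
    refine Finset.sum_congr rfl fun W hW => ?_
    rw [hpt W hW]
    simp only [cellWt3, mWt, Finset.union_empty]
    by_cases hp : p ∈ W <;> by_cases hr : r ∈ W <;> by_cases hq : q ∈ W <;> simp [hp, hr, hq]
  have hFb : ∑ W ∈ U.powerset, ν W * rVal A r q a δ ε W * (if r ∈ W then (1 : R) else 0) =
      (1 - δ) * A_pr + δ * A_apr + (1 - δ) * (1 - ε) * A_pqr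
        + (δ * ε + δ * (1 - ε) + (1 - δ) * ε) * A_apqr := by
    rw [sum_eq_sum_goodWt' U ν p r hbad]
    simp only [hA_pr, hA_apr, hA_pqr, hA_apqr, cellSum3, Finset.mul_sum, ← Finset.sum_add_distrib]
    refine Finset.sum_congr rfl fun W hW => ?_
    rw [hpt W hW]
    simp only [cellWt3, mWt, Finset.union_empty]
    by_cases hp : p ∈ W <;> by_cases hr : r ∈ W <;> by_cases hq : q ∈ W <;> simp [hp, hr, hq]
  have hM : ∑ W ∈ U.powerset, ν W * gVal A r q a w δ ε W =
      A_e + A_p + (1 - ε) * A_q + ε * A_aqw + (1 - ε) * A_pq + ε * A_apqw + (1 - δ) * A_pr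
        + δ * A_aprw + (1 - δ) * (1 - ε) * A_pqr
        + (δ * ε + δ * (1 - ε) + (1 - δ) * ε) * A_apqrw := by
    rw [sum_eq_sum_goodWt U ν p r hbad]
    simp only [hA_e, hA_p, hA_q, hA_aqw, hA_pq, hA_apqw, hA_pr, hA_aprw, hA_pqr, hA_apqrw, cellSum3,
      Finset.mul_sum, ← Finset.sum_add_distrib]
    exact Finset.sum_congr rfl hpg
  have hX : ∑ W ∈ U.powerset, ν W * gVal A r q a w δ ε W * (if p ∈ W then (1 : R) else 0) =
      A_p + (1 - ε) * A_pq + ε * A_apqw + (1 - δ) * A_pr + δ * A_aprw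
        + (1 - δ) * (1 - ε) * A_pqr + (δ * ε + δ * (1 - ε) + (1 - δ) * ε) * A_apqrw := by
    rw [sum_eq_sum_goodWt' U ν p r hbad]
    simp only [hA_p, hA_pq, hA_apqw, hA_pr, hA_aprw, hA_pqr, hA_apqrw, cellSum3, Finset.mul_sum,
      ← Finset.sum_add_distrib]
    refine Finset.sum_congr rfl fun W hW => ?_
    rw [hpg W hW]
    simp only [cellWt3, mWt, Finset.union_empty]
    by_cases hp : p ∈ W <;> by_cases hr : r ∈ W <;> by_cases hq : q ∈ W <;> simp [hp, hr, hq]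
  have hY : ∑ W ∈ U.powerset, ν W * gVal A r q a w δ ε W * (if r ∈ W then (1 : R) else 0) =
      (1 - δ) * A_pr + δ * A_aprw + (1 - δ) * (1 - ε) * A_pqr
        + (δ * ε + δ * (1 - ε) + (1 - δ) * ε) * A_apqrw := by
    rw [sum_eq_sum_goodWt' U ν p r hbad]
    simp only [hA_pr, hA_aprw, hA_pqr, hA_apqrw, cellSum3, Finset.mul_sum,
      ← Finset.sum_add_distrib]
    refine Finset.sum_congr rfl fun W hW => ?_
    rw [hpg W hW]
    simp only [cellWt3, mWt, Finset.union_empty]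
    by_cases hp : p ∈ W <;> by_cases hr : r ∈ W <;> by_cases hq : q ∈ W <;> simp [hp, hr, hq]
  have hXY : ∑ W ∈ U.powerset, ν W * gVal A r q a w δ ε W *
      ((if p ∈ W then (1 : R) else 0) * (if r ∈ W then (1 : R) else 0)) =
      (1 - δ) * A_pr + δ * A_aprw + (1 - δ) * (1 - ε) * A_pqr
        + (δ * ε + δ * (1 - ε) + (1 - δ) * ε) * A_apqrw := by
    rw [sum_eq_sum_goodWt' U ν p r hbad]
    simp only [hA_pr, hA_aprw, hA_pqr, hA_apqrw, cellSum3, Finset.mul_sum,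
      ← Finset.sum_add_distrib]
    refine Finset.sum_congr rfl fun W hW => ?_
    rw [hpg W hW]
    simp only [cellWt3, mWt, Finset.union_empty]
    by_cases hp : p ∈ W <;> by_cases hr : r ∈ W <;> by_cases hq : q ∈ W <;> simp [hp, hr, hq]
  rw [hΛ, hFa, hFb, hM, hX, hY, hXY]
  linear_combination key

end OrTailPrAlg

end Summit.Ventures.PercRepro2.Coin
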